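import Summits.BirchSwinnertonDyer.Rank1Residual.X11b.RouteR1LocalKernelRecord
import Summits.BirchSwinnertonDyer.Rank1Residual.Additive.N10LowerHalfStatements
import Literature.NumberTheory.EllipticCurves.AnticyclotomicPrimeDecompositionSplitProofs
import HarnessLib

/-!
# Crux `AnticycControlAdditiveK` (route `SchneiderFreeAdditiveX3`, stmt-BirchSwinnertonDyer-19295):
# the registered stub `stub_localKernelOrder` (P11) of skeleton v3-K, PROVED UNCONDITIONALLY

Seat `bsd-schneider-door-c6` (cell `bsd-schneider-ideate`), gen 4.  The local Tamagawa atom (P11)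
of door-c4's torsion-robust control count (`additiveControlOnTreeAt_of_torsAtoms`, p420051) —
`X11b.R1LocalKernelOrderAt W p`: for every imaginary quadratic `K`, every anticyclotomic
`ℤ_p`-extension `κ` and every `w ∈ Σ(N⁺)` (a place `w ∤ p` above a prime `ℓ ∣ N_E` SPLIT in `K`),
`#ker(H¹(K_w, E[p^∞]) → H¹(K_{∞,η}, E[p^∞])) = c_w^{(p)}(E/K)` (Jetchev–Skinner–Wan 2017 Prop. 3.3.4
Case 1(a) / Greenberg LNM 1716 Lemma 3.3) — was registered by the route base unit P2 g8 as the stub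
`stub_localKernelOrder` of the skeleton v3-K «torsAtoms shape» (sha16 c0242a50) on the crux
`AnticycControlAdditiveK`, with signature `Additive.N10.Locus W p → X11b.R1LocalKernelOrderAt W p`
VERBATIM.  The X11b route-R1 theorem `r1LocalKernelOrderAt_of_anticyclotomicDecomposition` reduces it
to ONE cited fact, Brink 2007 Thm. 2 (`ZpExtension.decomp_not_le_kerSubgroup_of_isAnticyclotomic`:
such `w` are finitely decomposed in `K_∞^{ac}`), plus `p ≠ 2` (first conjunct of `N10.Locus`).  That
fact is now a THEOREM of the tree (`decomp_not_le_kerSubgroup_of_isAnticyclotomic_holds`,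
`Literature/…/AnticyclotomicPrimeDecompositionSplitProofs.lean`, this seat, idelic class field theory),
so the stub holds UNCONDITIONALLY — and with it conjunct (iii) of the route's facts binder
`ControlFacts` (stmt-BirchSwinnertonDyer-19538) and the hypothesis `hBr` of X11b route R1's statement
of record (`R1.bsdp_of_onTree_final`).

HONEST FRAMING: closes nothing by itself (one of six registered stubs of the crux; `stub_kerRes`,
`stub_kerLoc` landed before, the Poitou–Tate-type stubs remain F2-class); BSD is not proved by any of
this.  Theorems only; no `Prop` fact; no `sorry`; standard axioms.

References: [Brink2007] Thm. 2, Cor. 1 (pp. 2134–2136); [JetchevSkinnerWan2017] Prop. 3.3.4 Case 1(a)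
(arXiv:1512.06894 pp. 12–13); [GreenbergLNM1716] §3 Lemma 3.3 (p. 87).
-/

noncomputable section

open scoped Classical

open WeierstrassCurve NumberField IsDedekindDomain Field Literature.NumberTheory.EllipticCurves
  Literature.NumberTheory.EllipticCurves.GreenbergSelmer
  Literature.NumberTheory.GaloisRepresentations
  Literature.NumberTheory.EllipticCurves.Rank1Residual
  Summit.BirchSwinnertonDyer.Rank1Residual
  Summit.BirchSwinnertonDyer.Rank1Residual.X11b

set_option linter.dupNamespace false

namespace Summit.BirchSwinnertonDyer.BirchSwinnertonDyer.Theorems.SchneiderFreeAdditiveX3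

/-- **Brink 2007 Thm. 2 at every number field `K : Type` and prime `p`** — the `∀ K p` form of the
cited fact consumed by X11b route R1 and by the K1 door's `ControlFacts` (iii), now a theorem.
[cite: Brink2007, Thm. 2 and Cor. 1 (pp. 2134–2136)] -/
theorem decomp_not_le_kerSubgroup_of_isAnticyclotomic_forall :
    ∀ (K : Type) [Field K] [NumberField K] (p : ℕ) [Fact p.Prime],
      ZpExtension.decomp_not_le_kerSubgroup_of_isAnticyclotomic K p :=
  fun K _ _ p _ => ZpExtension.decomp_not_le_kerSubgroup_of_isAnticyclotomic_holds K p

/-- **Registered stub `stub_localKernelOrder` of crux `AnticycControlAdditiveK` (skeleton v3-K),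
signature verbatim: the local Tamagawa atom (P11) `X11b.R1LocalKernelOrderAt W p` on the additive
locus `N10.Locus W p`** — at every imaginary quadratic `K`, every anticyclotomic `κ` and every
`w ∈ Σ(N⁺)`, `#ker(H¹(K_w, E[p^∞]) → H¹(K_{∞,η}, E[p^∞])) = c_w^{(p)}(E/K)`: `w` is finitely decomposed
in `K_∞^{ac}` (Brink 2007 Thm. 2, PROVED: `decomp_not_le_kerSubgroup_of_isAnticyclotomic_holds`), so
the exact Greenberg Lemma 3.3 of the tree applies (`r1LocalKernelOrderAt_of_anticyclotomicDecomposition`);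
`p ≠ 2` is the first conjunct of `N10.Locus`.  Unconditional.
[cite: JetchevSkinnerWan2017, Prop. 3.3.4 Case 1(a) (arXiv:1512.06894 pp. 12–13)]
[cite: GreenbergLNM1716, §3 Lemma 3.3 (p. 87)] [cite: Brink2007, Thm. 2 and Cor. 1 (pp. 2134–2136)] -/
theorem stub_localKernelOrder :
    ∀ (W : WeierstrassCurve ℚ) [W.IsElliptic] [W.IsGloballyMinimal] (p : ℕ) [Fact p.Prime],
      Additive.N10.Locus W p → X11b.R1LocalKernelOrderAt W p :=
  fun W _ _ p _ hN10 =>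
    r1LocalKernelOrderAt_of_anticyclotomicDecomposition W p
      decomp_not_le_kerSubgroup_of_isAnticyclotomic_forall hN10.1

end Summit.BirchSwinnertonDyer.BirchSwinnertonDyer.Theorems.SchneiderFreeAdditiveX3

end
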